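import Mathlib
import Literature.MathematicalPhysics.QuantumFieldTheory.Balaban1983to89.B13

/-!
# `Balaban1983to89.B13Sect1Arith` — kernel certificate of the elementary arithmetic of B13 Sect. 1, pp. 5–9

CITATION HEADER (lean-in-tree rule 2026-08-18).  T. Bałaban, *Renormalization group approach to lattice gauge field
theories. II. Cluster expansions*, Commun. Math. Phys. **116**, 1–22 (1988) [Balaban1988RG2Cluster] (cell paper B13;
held `paper:balaban1988-cmp116-rg-ii-cluster`, journal page = PDF page), Sect. 1 pp. 4–9, render-checked 2026-08-18 on
`b2b-balaban-ref1/pages/1988-cmp116-rg-II-cluster/1988-cmp116-rg-II-cluster-p004-x2.png` … `…-p009-x2.png` (read as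
images, not from the OCR layer; every display quoted below and in the docstrings was compared with the render).  The
paper is UNDER ADJUDICATION by the audit cell `pub-balaban`; nothing of it is asserted here: every printed analytic
input (the leaf bounds (1.11), (1.13), (98) and Proposition 4 of [15], (I.3.54), (1.26), the cube counts, the
geometric inputs G1/G2 of the cell census) enters as an explicit HYPOTHESIS over abstract reals / finite index sets,
and what is proved is proved by the kernel from Mathlib (real arithmetic, `Real.add_one_le_exp`, `Real.exp_one_gt_d9`,
the circle-integral norm bound `circleIntegral.norm_two_pi_i_inv_smul_integral_le_of_norm_le_const`, `geom_sum_eq`)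
and from the sibling module `…Balaban1983to89.B13` (units r2/b13: its subset-sum lemma `B13.sum_powerset_le_exp_234`,
the computation shared by (1.27) and (2.34)).  This module is a NEW sibling of `B13.lean`, `B13Closing.lean`,
`B13Ineq140.lean` ((1.39) ⇒ (1.40), same unit), `B12TreeDecay.lean` ((1.26) = (3.27) of B12, kernel modulo a volume
leaf) and `TreeLength.lean` (the tree-length facts behind G1/G2); it imports Mathlib and `B13` and modifies nothing.
Unit `b2b-balaban-pv20-g2` (surge node prover #20, gen 2); cell records GAPS C-B13-01 (Sect. 1 (1.9)–(1.32) certified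
BY HAND with the restriction census R1–R10 and geometric inputs G1, G2 — `HOME/b2b-balaban-b13/transcript-B13.md`),
G-B13-07 ((1.28)/(2.30) lower half false as printed, repaired), C-pv20-5 (this kernel certificate), D-pv20.5 (the
modelling conventions listed at the end of this header).  v1.1 (2026-08-18, after the cross-read GAPS C-pv14-23):
DOCFIX G-pv14-6 (attribution of the "sufficiently large" provisos), the additive `radius_122_R7_sharp` (R7's sharp
consequence 1/|t_□| < ½, cross-read remark R1) and the two reproduced print slips marked [sic] (remark R3); no v1
statement changed.

WHAT IS PRINTED.  The displays (1.13)–(1.32) and the sentences between them are quoted VERBATIM in the docstring of the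
declaration that certifies each step (pp. 5–9); the restrictions of the cell census appear under their census names:
R2 *"for ε₂ satisfying 4C₂B₀e^{16κ₁}ε₂ ≦ 1"* (p. 5), R3 *"The last inequality holds if 4C₄B₀²e^{32κ₁}ε₃ ≦ 1"* (p. 6),
R4 *"and we assume that 2B₀e^{16κ₁}ε₃ ≦ ε₂"* (p. 6), R5 (implicit in *"where C₁ is an absolute constant"*, p. 6), R6
(ε₃ ↤ C₁ε₁, (1.20)–(1.21)), R8 *"if ¼(κ₁ − 1) ≧ (1 − δ)κ, 0 < δ < 1"* (p. 9), R9 *"We assume that (1/16)κ₁ ≧ (1 − 2δ)κ"*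
(p. 9), the three printed *"sufficiently large"* of pp. 8–9 — (1.26) *"for κ sufficiently large"* (p. 8), (1.27) *"for κ₁
sufficiently large"* (p. 8), and the p. 9 use of (1.26) *"and the inequality (1.26) for δκ sufficiently large"* — and
the two UNPRINTED, implicit restrictions the kernel makes explicit (no proviso is printed after them): the second "≦"
of (1.28) needs κ₁ ≥ 2 + 16 log 24 and the second "≦" of the p. 9 cube-sum display needs δκ ≥ log 24 (both for
d_k(Y) ≥ 1; v1.1 wording, cell GAPS G-pv14-6).

WHAT THIS FILE CERTIFIES (zero `sorry`; b := B₀e^{16κ₁} throughout Part A).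
* Part A (pp. 5–7, the contraction radii): `radius_113`, `selfmap_113` (R2 ⇒ the right side of (1.13) maps
  {|X| < 4C₂ε₂²} into itself and 4C₂ε₂² ≦ (4C₂b²)⁻¹), `two_eps2_114` (|A| < ε₂ + b4C₂ε₂² ≦ 2ε₂), `last_ineq_115`,
  `chain_115`, `norm_bound_115` (R3 ⇒ the proviso and the last two steps of (1.15), and bε₃ + 4C₄b³ε₃² ≦ 2bε₃),
  `chain_116` ((1.16) after its first step, R3 + R4), `bound_118` + `tail_118` (THE CONSTANT 4 OF (1.18) EXACTLY, from
  the three pieces of (1.17) with the leaf bounds (1.11), (1.14), (1.16) as hypotheses, under R2–R4 — the print does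
  not spell this step out), `bound_120`, `lt_120`, `C₁_le_120` ((1.20) with the explicit C₁ = c₀(1 + 4C₂c₀ε₁) ≤ 2c₀
  under R5: 4C₂c₀ε₁ ≤ 1), `bound_121`, `eq_122`, `lt_122`, `radius_122_R7_sharp` ((1.21), (1.22); with R7 the
  t_□-circle has 1/|t_□| < ½, i.e. radius |t_□| > 2 — p. 7 *"satisfies (I.3.31) with ½α₂"*; v1's a-fortiori
  `radius_122_R7`, ≤ 2, is kept), `inspection_121` (the *"absolute constant … obtained by inspection"* of p. 7 made
  explicit: with ε₃ := C₁ε₁, ε₂ := 2bε₃, R2 ∧ R3 ∧ R4 ⟸ B₀²e^{32κ₁}ε₁·8C₂C₁ ≤ 1 ∧ B₀²e^{32κ₁}ε₁·4C₄C₁ ≤ 1).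
* Part B (p. 7, (1.23) ⇒ (1.24)): the iterated contour integral of (1.23) is modelled LITERALLY as an iterated
  one-variable operation `cauchyOp ρ l h` over the list `l` of cubes Δ ⊂ Y₀∖□̃⁴ (∫₀¹ds(Δ) (2πi)⁻¹∮_{|σ(Δ)|=ρ}
  dσ(Δ)/(σ(Δ) − s(Δ))², ρ = e^{κ₁}) applied to an arbitrary integrand with values in a complex normed space, and
  `norm_cauchy_t`, `norm_cauchy_sigma`, `norm_step`, `norm_cauchyOp_le`, `norm_cauchyOp_le'` prove the norm bound
  (1/r)·(ρ(ρ − 1)⁻²)^{N}·sup‖integrand‖ with NO integrability or analyticity hypothesis (Mathlib's interval and circle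
  integral norm bounds); `cauchy_factor_le` is the numerical fact e^{κ₁}(e^{κ₁} − 1)⁻² ≤ e^{−(κ₁−1)} for κ₁ ≥ 1 (cell
  C-B13-01: "≤ 2.503e^{−κ₁}"), `cauchy_factor_pow_le` its N-th power, and `bound_124` assembles LITERALLY (1.24):
  ‖(1.23)‖ ≤ (1/r)·S·exp(−(κ₁ − 1)N) with 1/r = (1.22) and S = the (I.3.54) bound (hypothesis).
* Part C (p. 7): `exponent_125`, `bound_125` — (1.24) ⇒ (1.25) under G1 (d_k(Y) ≤ d_k(□₀) + 4N, hypothesis), κ₁ ≥ 1.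
* Part D (p. 8): `threshold_127` + `bound_127` ((1.27) with the explicit threshold κ₁ ≥ 1 + 2 log(8·12³) ≈ 20.07),
  `jsum_le` (Σ_{j≤k}(6L)⁴L^jη ≤ 2(6L)⁴ for η = L^{−k}, L ≥ 2), `lin_le_exp`, `one_le_log_24`, `bound_128_printed`
  ((1.28) as printed: G2 hypothesis, d_k(Y) ≥ 1, explicit threshold κ₁ ≥ 2 + 16 log 24 ≈ 52.85), `affine_le_exp`,
  `bound_128_repaired` ((1.28) from the TRUE additive volume bound N ≤ A(d_k(Y) + 1) of `TreeLength.card_le_treeLen`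
  plus a floor d_k(Y) ≥ d₀ > 0, threshold κ₁ ≥ 2 + 16 log(A(d₀ + 1))/d₀ — GAPS G-B13-07), `exponent_129` (the rates
  −⅛(κ₁ − 1) + (1/16)(κ₁ − 2) = −(1/16)κ₁ EXACTLY), `gather_129` (the nested sum over □₀, Y₀, j, □′, X bounded by
  K·O(1)·2(6L)⁴·e·exp(⅛κ₁d_k(□₀))·exp(−(1/16)κ₁d_k(Y)) from the level bounds exactly as the text states them —
  the printed shape of (1.29) with every factor explicit).
* Part E (p. 9): `bound_132` ((1.30) + (1.31) + G1 + R8 ⇒ (1.32)), `factor_Ljη` (the first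
  exponential of (1.30) yields the factor L^jη once δ₀M ≥ 2/e), `cubesum_p9` (M⁻⁴|Y| ≦ 3·2³d_k(Y) ≦ exp δκd_k(Y) as
  printed: G2 hypothesis, threshold δκ ≥ log 24), `rate_R9`, `shape_136` (R9 ⇒ exp(−(1/16)κ₁d) ≤ exp(−(1 − 2δ)κd),
  whence the rate of (1.36)).
NOT certified here (hypotheses, by name in the docstrings): the leaf bounds (1.11), the first "≦" of (1.13), (1.15),
(1.16), (1.20) (Sect. C and Proposition 4 of [15] = B11: GAPS G-B13-01…05), (I.3.54) of [Balaban1987RG1], (1.26)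
(kernel elsewhere: `…B12TreeDecay`), the cube counts 8·12³ and (6L)⁴ (taken as the paper's numerals), G1 and G2
(`…TreeLength` proves d(Y) ≤ #(Y∖X) + d(X) and |Y| ≤ 2^d(4d(Y) + 1); G2 as printed is false for linear size 0), the
identification of the gathered constant with "E₀ε₁O(M^q) exp O(1)κ₁" (it presupposes B12's choice of the α's as powers
of M), and Cauchy's integral formula itself (that (1.23) EQUALS the s-derivatives of (1.10) — [folklore], not
re-derived; only the printed integral expression is bounded).  MODELLING CONVENTIONS (DIVERGENCE D-pv20.5): norms of
field functionals are abstract nonnegative reals; b abbreviates B₀e^{16κ₁}; the families {□₀}, {Y₀}, {□′}, {X} are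
abstract finite index sets with the printed level bounds as hypotheses; the ordered product in (1.23) is a `List`.
Value = kernel certificate of printed bookkeeping with every implicit threshold made explicit, NOT summit progress.
-/

noncomputable section

namespace Literature.MathematicalPhysics.QuantumFieldTheory.Balaban1983to89.B13Sect1Arith

open Literature.MathematicalPhysics.QuantumFieldTheory.Balaban1983to89

/-! ## Part A. pp. 5–6: the contraction radii ε₂, ε₃ and the bounds (1.13)–(1.22)
Throughout `b` stands for the printed product B₀e^{16κ₁} (p. 6 l. 1 *"bounded by B₀e^{16κ₁}"*). -/

/-- p. 5, after (1.13): *"for ε₂ satisfying 4C₂B₀e^{16κ₁}ε₂ ≦ 1"* (restriction R2 of the cell census) the two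
radii are nested: 4C₂ε₂² ≦ (4C₂B₀²e^{32κ₁})⁻¹. [cite: Balaban1988RG2Cluster, (1.13) p.5] -/
theorem radius_113 {C₂ b ε₂ : ℝ} (hC : 0 < C₂) (hb : 0 < b) (hε : 0 ≤ ε₂) (hR2 : 4 * C₂ * b * ε₂ ≤ 1) :
    4 * C₂ * ε₂ ^ 2 ≤ (4 * C₂ * b ^ 2)⁻¹ := by
  rw [inv_eq_one_div, le_div_iff₀ (by positivity)]
  have h1 : 0 ≤ 4 * C₂ * b * ε₂ := by positivity
  calc 4 * C₂ * ε₂ ^ 2 * (4 * C₂ * b ^ 2) = (4 * C₂ * b * ε₂) ^ 2 := by ring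
    _ ≤ 1 := pow_le_one₀ h1 hR2

/-- p. 5, the self-map step after (1.13), verbatim: *"and for X satisfying |X| < 4C₂ε₂² ≦ (4C₂B₀²e^{32κ₁})⁻¹, hence
for ε₂ satisfying 4C₂B₀e^{16κ₁}ε₂ ≦ 1, the right-hand side above is bounded by 4C₂ε₂². Thus the
transformation defined by the function on the left-hand side of (1.13) maps the domain {X : |X| < 4C₂ε₂²} into
itself."* — the right-hand side of (1.13) being 2C₂ε₂² + 2C₂B₀²e^{32κ₁}|X|². Kernel: under R2 and 0 ≤ |X| < 4C₂ε₂²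
it is ≤ 4C₂ε₂².
[cite: Balaban1988RG2Cluster, (1.13) p.5] -/
theorem selfmap_113 {C₂ b ε₂ x : ℝ} (hC : 0 ≤ C₂) (hb : 0 ≤ b) (hε : 0 ≤ ε₂) (hR2 : 4 * C₂ * b * ε₂ ≤ 1)
    (hx0 : 0 ≤ x) (hx : x < 4 * C₂ * ε₂ ^ 2) :
    2 * C₂ * ε₂ ^ 2 + 2 * C₂ * b ^ 2 * x ^ 2 ≤ 4 * C₂ * ε₂ ^ 2 := by
  have h1 : x ^ 2 ≤ (4 * C₂ * ε₂ ^ 2) ^ 2 := pow_le_pow_left₀ hx0 hx.le 2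
  have h2 : (4 * C₂ * b * ε₂) ^ 2 ≤ 1 := pow_le_one₀ (by positivity) hR2
  have h3 : 2 * C₂ * b ^ 2 * x ^ 2 ≤ 2 * C₂ * ε₂ ^ 2 := by
    calc 2 * C₂ * b ^ 2 * x ^ 2 ≤ 2 * C₂ * b ^ 2 * (4 * C₂ * ε₂ ^ 2) ^ 2 :=
          mul_le_mul_of_nonneg_left h1 (by positivity)
      _ = 2 * C₂ * ε₂ ^ 2 * (4 * C₂ * b * ε₂) ^ 2 := by ring
      _ ≤ 2 * C₂ * ε₂ ^ 2 * 1 := mul_le_mul_of_nonneg_left h2 (by positivity)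
      _ = 2 * C₂ * ε₂ ^ 2 := by ring
  linarith

/-- p. 5, verbatim: *"the transformation (1.12) can be bounded as in (57) [15]: |A| < ε₂ + B₀e^{16κ₁}4C₂ε₂² ≦ 2ε₂"*
— the second inequality, under R2. [cite: Balaban1988RG2Cluster, (1.14) p.5] -/
theorem two_eps2_114 {C₂ b ε₂ : ℝ} (hε : 0 ≤ ε₂) (hR2 : 4 * C₂ * b * ε₂ ≤ 1) :
    ε₂ + b * (4 * C₂ * ε₂ ^ 2) ≤ 2 * ε₂ := by
  have : b * (4 * C₂ * ε₂ ^ 2) = (4 * C₂ * b * ε₂) * ε₂ := by ring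
  rw [this]
  nlinarith

/-- p. 6, verbatim: *"The last inequality holds if 4C₄B₀²e^{32κ₁}ε₃ ≦ 1"* (restriction R3) — the last inequality
being 4C₄(B₀e^{16κ₁})³ε₃² ≦ (4C₄B₀e^{16κ₁})⁻¹ in the proviso of (1.15). [cite: Balaban1988RG2Cluster, (1.15) p.6] -/
theorem last_ineq_115 {C₄ b ε₃ : ℝ} (hC : 0 < C₄) (hb : 0 < b) (hε : 0 ≤ ε₃) (hR3 : 4 * C₄ * b ^ 2 * ε₃ ≤ 1) :
    4 * C₄ * b ^ 3 * ε₃ ^ 2 ≤ (4 * C₄ * b)⁻¹ := by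
  rw [inv_eq_one_div, le_div_iff₀ (by positivity)]
  calc 4 * C₄ * b ^ 3 * ε₃ ^ 2 * (4 * C₄ * b) = (4 * C₄ * b ^ 2 * ε₃) ^ 2 := by ring
    _ ≤ 1 := pow_le_one₀ (by positivity) hR3

/-- **(1.15)** p. 6, the chain of its last two steps, verbatim: *"≦ 2C₄(B₀e^{16κ₁})³|B′|² +
2C₄B₀e^{16κ₁}(max{|A|, |∇A|})² < 2C₄(B₀e^{16κ₁})³ε₃² + ½max{|A|, |∇A|} < 4C₄(B₀e^{16κ₁})³ε₃², (1.15) if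
max{|A|, ∇A|} [sic: the bar before ∇A is dropped in print] < 4C₄(B₀e^{16κ₁})³ε₃² ≦ (4C₄B₀e^{16κ₁})⁻¹, and if
|B′| < ε₃, where ε₃ is another auxiliary constant."*  Here `nB` = |B′|, `m` = max{|A|, |∇A|}; the first "≦" is
(98) of [15] and is NOT reproduced.
[cite: Balaban1988RG2Cluster, (1.15) p.6] -/
theorem chain_115 {C₄ b ε₃ nB m : ℝ} (hC : 0 < C₄) (hb : 0 < b) (hnB0 : 0 ≤ nB) (hnB : nB < ε₃) (hm0 : 0 ≤ m)
    (hm : m < 4 * C₄ * b ^ 3 * ε₃ ^ 2) (hlast : 4 * C₄ * b ^ 3 * ε₃ ^ 2 ≤ (4 * C₄ * b)⁻¹) :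
    2 * C₄ * b ^ 3 * nB ^ 2 + 2 * C₄ * b * m ^ 2 < 2 * C₄ * b ^ 3 * ε₃ ^ 2 + (1 / 2) * m ∧
      2 * C₄ * b ^ 3 * ε₃ ^ 2 + (1 / 2) * m < 4 * C₄ * b ^ 3 * ε₃ ^ 2 := by
  have hsq : nB ^ 2 < ε₃ ^ 2 := by
    have := hnB0.trans_lt hnB
    nlinarith
  have h1 : 2 * C₄ * b ^ 3 * nB ^ 2 < 2 * C₄ * b ^ 3 * ε₃ ^ 2 := mul_lt_mul_of_pos_left hsq (by positivity)
  have hm1 : m * (4 * C₄ * b) ≤ 1 := by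
    have := hm.le.trans hlast
    rwa [inv_eq_one_div, le_div_iff₀ (by positivity)] at this
  have h2 : 2 * C₄ * b * m ^ 2 ≤ (1 / 2) * m := by
    have : 2 * C₄ * b * m ^ 2 = (1 / 2) * m * (m * (4 * C₄ * b)) := by ring
    rw [this]
    calc (1 / 2) * m * (m * (4 * C₄ * b)) ≤ (1 / 2) * m * 1 := mul_le_mul_of_nonneg_left hm1 (by positivity)
      _ = (1 / 2) * m := by ring
  constructor
  · linarith
  · linarith

/-- p. 6, verbatim: *"The norm of the function H₀(s(Y₀))B′ + A is bounded by B₀e^{16κ₁}ε₃ + 4C₄(B₀e^{16κ₁})³ε₃² ≦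
2B₀e^{16κ₁}ε₃"* — the "≦", under R3. [cite: Balaban1988RG2Cluster, (1.15) p.6] -/
theorem norm_bound_115 {C₄ b ε₃ : ℝ} (hb : 0 ≤ b) (hε : 0 ≤ ε₃) (hR3 : 4 * C₄ * b ^ 2 * ε₃ ≤ 1) :
    b * ε₃ + 4 * C₄ * b ^ 3 * ε₃ ^ 2 ≤ 2 * b * ε₃ := by
  have : 4 * C₄ * b ^ 3 * ε₃ ^ 2 = (4 * C₄ * b ^ 2 * ε₃) * (b * ε₃) := by ring
  rw [this]
  nlinarith [mul_nonneg hb hε]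

/-- **(1.16)** p. 6, verbatim: *"|A₀(s(Y₀), H₀(s(Y₀))B′)| ≦ 4C₄(B₀e^{16κ₁})³|B′|² < 4C₄(B₀e^{16κ₁})³ε₃² ≦ B₀e^{16κ₁}ε₃ ≦
½ε₂, (1.16)"*, the three steps after the first (which is Proposition 4 of [15], not reproduced): under |B′| < ε₃,
R3 and the assumption *"we assume that 2B₀e^{16κ₁}ε₃ ≦ ε₂"* (R4). [cite: Balaban1988RG2Cluster, (1.16) p.6] -/
theorem chain_116 {C₄ b ε₂ ε₃ nB : ℝ} (hC : 0 < C₄) (hb : 0 < b) (hnB0 : 0 ≤ nB) (hnB : nB < ε₃)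
    (hR3 : 4 * C₄ * b ^ 2 * ε₃ ≤ 1) (hR4 : 2 * b * ε₃ ≤ ε₂) :
    4 * C₄ * b ^ 3 * nB ^ 2 < 4 * C₄ * b ^ 3 * ε₃ ^ 2 ∧ 4 * C₄ * b ^ 3 * ε₃ ^ 2 ≤ b * ε₃ ∧
      b * ε₃ ≤ (1 / 2) * ε₂ := by
  have hε : 0 ≤ ε₃ := hnB0.trans hnB.le
  refine ⟨mul_lt_mul_of_pos_left (by nlinarith) (by positivity), ?_, by linarith⟩
  have : 4 * C₄ * b ^ 3 * ε₃ ^ 2 = (4 * C₄ * b ^ 2 * ε₃) * (b * ε₃) := by ring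
  rw [this]
  nlinarith [mul_nonneg hb.le hε]

/-- **(1.18)** p. 6, verbatim: *"It is an analytic function of s(Y₀), B′, satisfying the bound |H_k(s(Y₀), B′)| ≦
4B₀e^{16κ₁}|B′| < 4B₀e^{16κ₁}ε₃ ≦ 2ε₂, (1.18)"*.  The first "≦" is not derived in print; this is its arithmetic
from the three pieces of (1.17) p. 6 (*"H_k(s(Y₀), B′) = H₀(s(Y₀))B′ + A₀(s(Y₀), H₀(s(Y₀))B′) − H(s(Y₀))D(H(s(Y₀)),
H₀(s(Y₀))′ [sic: B′ dropped in print] + A₀(s(Y₀), H₀(s(Y₀))B′))"*): with `n1` = |H₀(s(Y₀))B′| ≤ b|B′| (p. 5: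
H₀(s(Y₀)) has *"the same bound
(1.11)"*, i.e. b), `n2` = |A₀(…)| ≤ 4C₄b³|B′|² ((1.16)), `nx` = the norm of the argument x = H₀(s(Y₀))B′ + A₀(…) ≤
n1 + n2, `n3` = |H(s(Y₀))D(H(s(Y₀)), x)| ≤ b·4C₂|x|² ((1.11) and (1.14) *"|D(H(s(Y₀)), A′)| ≦ 4C₂|A′|²"*), and
|B′| < ε₃, R2, R3, R4: n1 + n2 + n3 ≤ 4b|B′| — the printed constant 4 exactly. The leaf bounds are HYPOTHESES.
[cite: Balaban1988RG2Cluster, (1.18) p.6] -/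
theorem bound_118 {C₂ C₄ b ε₂ ε₃ nB n1 n2 n3 nx : ℝ} (hC₂ : 0 ≤ C₂) (hC₄ : 0 ≤ C₄) (hb : 0 ≤ b) (hnB0 : 0 ≤ nB)
    (hnB : nB < ε₃) (hR2 : 4 * C₂ * b * ε₂ ≤ 1) (hR3 : 4 * C₄ * b ^ 2 * ε₃ ≤ 1) (hR4 : 2 * b * ε₃ ≤ ε₂)
    (h1 : n1 ≤ b * nB) (h2 : n2 ≤ 4 * C₄ * b ^ 3 * nB ^ 2) (hx0 : 0 ≤ nx) (hx : nx ≤ n1 + n2)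
    (h3 : n3 ≤ b * (4 * C₂ * nx ^ 2)) :
    n1 + n2 + n3 ≤ 4 * b * nB := by
  have hbn : 0 ≤ b * nB := mul_nonneg hb hnB0
  have hε : 0 ≤ ε₃ := hnB0.trans hnB.le
  -- n2 ≤ b nB · (4 C₄ b² nB) ≤ b nB
  have h2' : n2 ≤ b * nB := by
    have e : 4 * C₄ * b ^ 3 * nB ^ 2 = (b * nB) * (4 * C₄ * b ^ 2 * nB) := by ring
    have : 4 * C₄ * b ^ 2 * nB ≤ 1 :=
      (mul_le_mul_of_nonneg_left hnB.le (by positivity)).trans hR3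
    nlinarith
  -- |x| ≤ 2 b |B′| and |x| ≤ 2 b ε₃ ≤ ε₂
  have hx1 : nx ≤ 2 * (b * nB) := by linarith
  have hx2 : nx ≤ ε₂ := by
    have : b * nB ≤ b * ε₃ := mul_le_mul_of_nonneg_left hnB.le hb
    linarith
  -- b · 4C₂|x|² ≤ b · 4C₂ · (2b|B′|) ε₂ = 2 b|B′| · (4C₂ b ε₂) ≤ 2 b |B′|
  have h3' : n3 ≤ 2 * (b * nB) := by
    have hsq : nx ^ 2 ≤ (2 * (b * nB)) * ε₂ := by nlinarith
    have : b * (4 * C₂ * nx ^ 2) ≤ b * (4 * C₂ * ((2 * (b * nB)) * ε₂)) :=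
      mul_le_mul_of_nonneg_left (mul_le_mul_of_nonneg_left hsq (by positivity)) hb
    have e : b * (4 * C₂ * ((2 * (b * nB)) * ε₂)) = 2 * (b * nB) * (4 * C₂ * b * ε₂) := by ring
    nlinarith
  linarith

/-- (1.18) p. 6, its last two steps *"< 4B₀e^{16κ₁}ε₃ ≦ 2ε₂"*: from |B′| < ε₃ and R4 (*"2B₀e^{16κ₁}ε₃ ≦ ε₂"*).
[cite: Balaban1988RG2Cluster, (1.18) p.6] -/
theorem tail_118 {b ε₂ ε₃ nB : ℝ} (hb : 0 < b) (hnB : nB < ε₃) (hR4 : 2 * b * ε₃ ≤ ε₂) :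
    4 * b * nB < 4 * b * ε₃ ∧ 4 * b * ε₃ ≤ 2 * ε₂ :=
  ⟨mul_lt_mul_of_pos_left hnB (by positivity), by linarith⟩

/-- **(1.20)** p. 6, verbatim: *"It satisfies the bound |B′| ≦ O(1)g_k|B| + 4C₂(O(1)g_k|B|)² ≦ C₁g_k|B| < C₁ε₁, (1.20)
where C₁ is an absolute constant, and g_k|B| < ε₁."*  With `c₀` = the O(1) and `a` = g_k|B|, the middle "≦" holds
with the EXPLICIT C₁ := c₀(1 + 4C₂c₀ε₁); "absolute" presupposes C₂c₀ε₁ = O(1) (cell census R5; `C₁_le_120`).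
[cite: Balaban1988RG2Cluster, (1.20) p.6] -/
theorem bound_120 {c₀ C₂ a ε₁ : ℝ} (hc : 0 ≤ c₀) (hC : 0 ≤ C₂) (ha0 : 0 ≤ a) (ha : a < ε₁) :
    c₀ * a + 4 * C₂ * (c₀ * a) ^ 2 ≤ (c₀ * (1 + 4 * C₂ * c₀ * ε₁)) * a := by
  have : c₀ * a + 4 * C₂ * (c₀ * a) ^ 2 = (c₀ * (1 + 4 * C₂ * c₀ * a)) * a := by ring
  rw [this]
  refine mul_le_mul_of_nonneg_right (mul_le_mul_of_nonneg_left ?_ hc) ha0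
  nlinarith [mul_nonneg hC hc]

/-- (1.20) p. 6, last step *"≦ C₁g_k|B| < C₁ε₁"* for a positive constant C₁ and g_k|B| < ε₁.
[cite: Balaban1988RG2Cluster, (1.20) p.6] -/
theorem lt_120 {C₁ a ε₁ : ℝ} (hC : 0 < C₁) (ha : a < ε₁) : C₁ * a < C₁ * ε₁ :=
  mul_lt_mul_of_pos_left ha hC

/-- (1.20) p. 6, *"where C₁ is an absolute constant"*: the explicit C₁ = c₀(1 + 4C₂c₀ε₁) of `bound_120` is ≤ 2c₀
as soon as 4C₂c₀ε₁ ≤ 1 (the implicit restriction R5 of the cell census made explicit). [cite: Balaban1988RG2Cluster, (1.20) p.6] -/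
theorem C₁_le_120 {c₀ C₂ ε₁ : ℝ} (hc : 0 ≤ c₀) (hR5 : 4 * C₂ * c₀ * ε₁ ≤ 1) :
    c₀ * (1 + 4 * C₂ * c₀ * ε₁) ≤ 2 * c₀ := by
  nlinarith

/-- **(1.21)** p. 7, verbatim: *"has the estimate |H_k(s(Y₀), B′)| ≦ 4B₀C₁e^{16κ₁}g_k|B| < 4B₀C₁e^{16κ₁}ε₁, (1.21)"* — from
(1.18) (|H_k| ≤ 4b|B′|) and (1.20) (|B′| ≤ C₁g_k|B|, g_k|B| < ε₁). [cite: Balaban1988RG2Cluster, (1.21) p.7] -/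
theorem bound_121 {b C₁ a ε₁ nH nB : ℝ} (hb : 0 < b) (hC : 0 < C₁) (h18 : nH ≤ 4 * b * nB) (h20 : nB ≤ C₁ * a)
    (ha : a < ε₁) : nH ≤ 4 * b * C₁ * a ∧ 4 * b * C₁ * a < 4 * b * C₁ * ε₁ := by
  refine ⟨h18.trans ?_, mul_lt_mul_of_pos_left ha (by positivity)⟩
  have := mul_le_mul_of_nonneg_left h20 (by positivity : (0:ℝ) ≤ 4 * b)
  linarith

/-- **(1.22)** p. 7, verbatim: *"we extend the expression in (1.10) analytically with respect to t_□ satisfying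
|t_□|4B₀C₁e^{16κ₁}g_k|B| ≦ ½α₂. Taking t_□ for which the equality holds, we get 1/|t_□| = 8B₀C₁e^{16κ₁}α₂⁻¹g_k|B| <
8B₀C₁e^{16κ₁}α₂⁻¹ε₁. (1.22)"* — the algebra of the equality case and the final "<" (g_k|B| < ε₁).
[cite: Balaban1988RG2Cluster, (1.22) p.7] -/
theorem eq_122 {b C₁ α₂ a r : ℝ} (hα : 0 < α₂) (hr : 0 < r) (h : r * (4 * b * C₁ * a) = (1 / 2) * α₂) :
    1 / r = 8 * b * C₁ * α₂⁻¹ * a := by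
  have hr' : r ≠ 0 := hr.ne'
  have hα' : α₂ ≠ 0 := hα.ne'
  field_simp
  field_simp at h
  linarith

/-- (1.22) p. 7, the final *"< 8B₀C₁e^{16κ₁}α₂⁻¹ε₁"*. [cite: Balaban1988RG2Cluster, (1.22) p.7] -/
theorem lt_122 {b C₁ α₂ a ε₁ : ℝ} (hb : 0 < b) (hC : 0 < C₁) (hα : 0 < α₂) (ha : a < ε₁) :
    8 * b * C₁ * α₂⁻¹ * a < 8 * b * C₁ * α₂⁻¹ * ε₁ :=
  mul_lt_mul_of_pos_left ha (by positivity)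

/-- p. 7, verbatim: *"We assume that 4B₀C₁e^{16κ₁}ε₁ ≦ ¼α₂"* (restriction R7): with it the right side of (1.22)
satisfies, a fortiori, 8B₀C₁e^{16κ₁}α₂⁻¹ε₁ ≦ 2 (v1; the SHARP consequence of R7 is ≦ ½ — `radius_122_R7_sharp`,
v1.1, cross-read remark R1 of cell GAPS C-pv14-23). [cite: Balaban1988RG2Cluster, (1.22) p.7] -/
theorem radius_122_R7 {b C₁ α₂ ε₁ : ℝ} (hα : 0 < α₂) (hR7 : 4 * b * C₁ * ε₁ ≤ (1 / 4) * α₂) :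
    8 * b * C₁ * α₂⁻¹ * ε₁ ≤ 2 := by
  have e : 8 * b * C₁ * α₂⁻¹ * ε₁ = 2 * (4 * b * C₁ * ε₁) / α₂ := by field_simp; ring
  rw [e, div_le_iff₀ hα]
  linarith

/-- R7 SHARP (v1.1): *"We assume that 4B₀C₁e^{16κ₁}ε₁ ≦ ¼α₂, and this implies that the product with tζ̃_□ satisfies
(I.3.31) with ½α₂"* (p. 7) — with R7 the right side of (1.22) is 8B₀C₁e^{16κ₁}α₂⁻¹ε₁ = 2·(4B₀C₁e^{16κ₁}ε₁)/α₂ ≦ ½,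
i.e. the t_□-circle (1.22) has 1/|t_□| < ½, radius |t_□| > 2. [cite: Balaban1988RG2Cluster, (1.22) p.7] -/
theorem radius_122_R7_sharp {b C₁ α₂ ε₁ : ℝ} (hα : 0 < α₂) (hR7 : 4 * b * C₁ * ε₁ ≤ (1 / 4) * α₂) :
    8 * b * C₁ * α₂⁻¹ * ε₁ ≤ 1 / 2 := by
  have e : 8 * b * C₁ * α₂⁻¹ * ε₁ = 2 * (4 * b * C₁ * ε₁) / α₂ := by field_simp; ring
  rw [e, div_le_iff₀ hα]
  linarith

/-- p. 7, verbatim: *"and the same for all admissible norms, if e^{32κ₁}ε₁ is smaller than an absolute constant. This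
constant can be easily obtained by inspection of all the above conditions."*  INSPECTION, kernel-checked: with the
choices ε₃ := C₁ε₁ ((1.20): |B′| < C₁ε₁ plays the part of |B′| < ε₃) and ε₂ := 2bε₃ (equality in R4), the
conditions R2 (4C₂bε₂ ≦ 1), R3 (4C₄b²ε₃ ≦ 1), R4 hold as soon as b²ε₁ · (8C₂C₁) ≤ 1 and b²ε₁ · (4C₄C₁) ≤ 1, where
b² = B₀²e^{32κ₁}: the "absolute constant" is 1/(B₀²C₁ max{8C₂, 4C₄}).  [cite: Balaban1988RG2Cluster, (1.21) p.7] -/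
theorem inspection_121 {B₀ κ₁ C₁ C₂ C₄ ε₁ : ℝ}
    (hA : B₀ ^ 2 * Real.exp (32 * κ₁) * ε₁ * (8 * C₂ * C₁) ≤ 1)
    (hB' : B₀ ^ 2 * Real.exp (32 * κ₁) * ε₁ * (4 * C₄ * C₁) ≤ 1) :
    let b := B₀ * Real.exp (16 * κ₁)
    let ε₃ := C₁ * ε₁
    let ε₂ := 2 * b * ε₃
    4 * C₂ * b * ε₂ ≤ 1 ∧ 4 * C₄ * b ^ 2 * ε₃ ≤ 1 ∧ 2 * b * ε₃ ≤ ε₂ := by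
  intro b ε₃ ε₂
  have hb2 : b ^ 2 = B₀ ^ 2 * Real.exp (32 * κ₁) := by
    simp only [b]; rw [mul_pow, ← Real.exp_nat_mul]; ring_nf
  refine ⟨?_, ?_, le_rfl⟩
  · calc 4 * C₂ * b * ε₂ = b ^ 2 * ε₁ * (8 * C₂ * C₁) := by simp only [ε₂, ε₃]; ring
      _ = B₀ ^ 2 * Real.exp (32 * κ₁) * ε₁ * (8 * C₂ * C₁) := by rw [hb2]
      _ ≤ 1 := hA
  · calc 4 * C₄ * b ^ 2 * ε₃ = b ^ 2 * ε₁ * (4 * C₄ * C₁) := by simp only [ε₃]; ring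
      _ = B₀ ^ 2 * Real.exp (32 * κ₁) * ε₁ * (4 * C₄ * C₁) := by rw [hb2]
      _ ≤ 1 := hB'

/-! ## Part B. p. 7: the Cauchy-formula bookkeeping (1.23) ⇒ (1.24)

(1.23) p. 7, verbatim: *"Let us come back to the expansion (1.10). We differentiate it with respect to t_□, at t_□ = 0,
and we represent all derivatives by the Cauchy formula. The term in (1.10) corresponding to a domain Y₀ is
represented as  (1/2πi)∫ dt_□/t_□² ∏_{Δ⊂Y₀∖□̃⁴} ∫ds(Δ) (1/2πi)∫ dσ(Δ)/(σ(Δ) − s(Δ))² · E(□₀, (tζ̃_□ +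
t_□ζ_□)H_k(σ(Y₀), B′)), (1.23) where the t_□-integration is over the circle (1.22), and the σ(Δ)-integrations are
over the circles |σ(Δ)| = e^{κ₁}."*  The s(Δ)-integrals are over [0, 1] ((1.10) p. 4: *"∫₀¹ ds(Δ)"*).  We model the
ordered product of one-variable operations literally (`cauchyOp`, a list of cubes; the integrand an arbitrary
function of the parameter vectors s, σ with values in a complex normed space) and prove the norm bound with one
factor ρ/(ρ − 1)² per cube, ρ = e^{κ₁} — no integrability or analyticity is needed for the BOUND. -/

section Cauchy

variable {E : Type*} [NormedAddCommGroup E] [NormedSpace ℂ E]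

open Complex in
/-- The t_□-circle of (1.23): for any integrand Φ with ‖Φ‖ ≤ S on the circle |t| = r,
‖(2πi)⁻¹∮_{|t|=r} Φ(t) dt/t²‖ ≤ S/r — the factor 1/|t_□| of (1.22) in (1.24). [folklore] -/
theorem norm_cauchy_t {Φ : ℂ → E} {r S : ℝ} (hr : 0 < r) (hΦ : ∀ t ∈ Metric.sphere (0:ℂ) r, ‖Φ t‖ ≤ S) :
    ‖(2 * Real.pi * I : ℂ)⁻¹ • ∮ t in C(0, r), (t ^ 2)⁻¹ • Φ t‖ ≤ S / r := by
  have h := circleIntegral.norm_two_pi_i_inv_smul_integral_le_of_norm_le_const hr.le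
    (f := fun t => (t ^ 2)⁻¹ • Φ t) (c := 0) (C := S / r ^ 2) ?_
  · calc _ ≤ r * (S / r ^ 2) := h
      _ = S / r := by field_simp
  · intro t ht
    have htn : ‖t‖ = r := by simpa using ht
    rw [norm_smul, norm_inv, norm_pow, htn, div_eq_inv_mul]
    exact mul_le_mul_of_nonneg_left (hΦ t ht) (by positivity)

open Complex in
/-- One σ(Δ)-circle of (1.23): for |s| ≤ 1 < ρ and ‖g‖ ≤ S on |σ| = ρ,
‖(2πi)⁻¹∮_{|σ|=ρ} g(σ) dσ/(σ − s)²‖ ≤ ρ(ρ − 1)⁻² S (on the circle |σ − s| ≥ ρ − 1). [folklore] -/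
theorem norm_cauchy_sigma {g : ℂ → E} {ρ S : ℝ} {s : ℂ} (hρ : 1 < ρ) (hs : ‖s‖ ≤ 1)
    (hg : ∀ σ ∈ Metric.sphere (0:ℂ) ρ, ‖g σ‖ ≤ S) :
    ‖(2 * Real.pi * I : ℂ)⁻¹ • ∮ σ in C(0, ρ), ((σ - s) ^ 2)⁻¹ • g σ‖ ≤ ρ / (ρ - 1) ^ 2 * S := by
  have h := circleIntegral.norm_two_pi_i_inv_smul_integral_le_of_norm_le_const (zero_le_one.trans hρ.le)
    (f := fun σ => ((σ - s) ^ 2)⁻¹ • g σ) (c := 0) (C := S / (ρ - 1) ^ 2) ?_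
  · calc _ ≤ ρ * (S / (ρ - 1) ^ 2) := h
      _ = ρ / (ρ - 1) ^ 2 * S := by ring
  · intro σ hσ
    have hσn : ‖σ‖ = ρ := by simpa using hσ
    have hd : ρ - 1 ≤ ‖σ - s‖ := by
      have := norm_sub_norm_le σ s
      have h2 : ‖σ‖ - ‖s‖ ≤ ‖σ - s‖ := by
        have := norm_le_norm_add_norm_sub' σ s  -- ‖σ‖ ≤ ‖s‖ + ‖σ - s‖
        linarith
      linarith
    have hpos : 0 < ρ - 1 := by linarith
    rw [norm_smul, norm_inv, norm_pow, div_eq_inv_mul]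
    refine mul_le_mul ?_ (hg σ hσ) (norm_nonneg _) (by positivity)
    exact inv_anti₀ (by positivity) (pow_le_pow_left₀ hpos.le hd 2)

open Complex in
/-- One factor ∫₀¹ds(Δ) (2πi)⁻¹∮ dσ(Δ)/(σ(Δ) − s(Δ))² of (1.23): if ‖h(s, σ)‖ ≤ S for s ∈ [0,1], |σ| = ρ (ρ > 1),
the double integral has norm ≤ ρ(ρ − 1)⁻²·S. [folklore] -/
theorem norm_step {h : ℝ → ℂ → E} {ρ S : ℝ} (hρ : 1 < ρ)
    (hh : ∀ u ∈ Set.Icc (0:ℝ) 1, ∀ σ ∈ Metric.sphere (0:ℂ) ρ, ‖h u σ‖ ≤ S) :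
    ‖∫ u in (0:ℝ)..1, (2 * Real.pi * I : ℂ)⁻¹ • ∮ σ in C(0, ρ), ((σ - (u:ℂ)) ^ 2)⁻¹ • h u σ‖
      ≤ ρ / (ρ - 1) ^ 2 * S := by
  have := intervalIntegral.norm_integral_le_of_norm_le_const (a := (0:ℝ)) (b := 1) (C := ρ / (ρ - 1) ^ 2 * S)
    (f := fun u => (2 * Real.pi * I : ℂ)⁻¹ • ∮ σ in C(0, ρ), ((σ - (u:ℂ)) ^ 2)⁻¹ • h u σ) ?_
  · simpa using this
  · intro u hu
    have hu' : u ∈ Set.Icc (0:ℝ) 1 := by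
      rw [Set.uIoc_of_le zero_le_one] at hu
      exact ⟨hu.1.le, hu.2⟩
    refine norm_cauchy_sigma hρ ?_ (hh u hu')
    rw [Complex.norm_real, Real.norm_eq_abs, abs_le]
    exact ⟨by linarith [hu'.1], hu'.2⟩

variable {ι : Type*} [DecidableEq ι]

open Complex in
/-- The ordered product ∏_{Δ∈l} ∫₀¹ds(Δ) (2πi)⁻¹∮_{|σ(Δ)|=ρ} dσ(Δ)/(σ(Δ) − s(Δ))² of (1.23), applied to a function
`h` of the parameter vectors (s, σ), as an iterated one-variable operation over a LIST of cubes (the printed ∏ is an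
ordered iteration; no Fubini is used or needed for the bound). [cite: Balaban1988RG2Cluster, (1.23) p.7] -/
def cauchyOp (ρ : ℝ) : List ι → ((ι → ℝ) → (ι → ℂ) → E) → (ι → ℝ) → (ι → ℂ) → E
  | [], h => h
  | i :: l, h => fun s σ => ∫ u in (0:ℝ)..1, (2 * Real.pi * I : ℂ)⁻¹ •
      ∮ z in C(0, ρ), ((z - (u:ℂ)) ^ 2)⁻¹ • cauchyOp ρ l h (Function.update s i u) (Function.update σ i z)

/-- THE NORM BOUND for the iterated Cauchy operation of (1.23): if the integrand is bounded by S on a set Q of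
parameter values closed under moving any listed coordinate inside [0,1] × {|σ| = ρ}, then on Q the iterated integral
is bounded by (ρ(ρ − 1)⁻²)^{#cubes}·S. [folklore] -/
theorem norm_cauchyOp_le {ρ S : ℝ} (hρ : 1 < ρ) (Q : (ι → ℝ) → (ι → ℂ) → Prop) :
    ∀ (l : List ι), (∀ s σ, Q s σ → ∀ i ∈ l, ∀ u ∈ Set.Icc (0:ℝ) 1, ∀ z ∈ Metric.sphere (0:ℂ) ρ,
        Q (Function.update s i u) (Function.update σ i z)) →
      ∀ h : (ι → ℝ) → (ι → ℂ) → E, (∀ s σ, Q s σ → ‖h s σ‖ ≤ S) →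
        ∀ s σ, Q s σ → ‖cauchyOp ρ l h s σ‖ ≤ (ρ / (ρ - 1) ^ 2) ^ l.length * S
  | [], _, h, hh, s, σ, hq => by simpa [cauchyOp] using hh s σ hq
  | i :: l, hQ, h, hh, s, σ, hq => by
    have IH := norm_cauchyOp_le hρ Q l (fun s σ hsσ j hj => hQ s σ hsσ j (List.mem_cons_of_mem i hj)) h hh
    have key := norm_step (E := E) hρ (S := (ρ / (ρ - 1) ^ 2) ^ l.length * S)
      (h := fun u z => cauchyOp ρ l h (Function.update s i u) (Function.update σ i z))
      (fun u hu z hz => IH _ _ (hQ s σ hq i (List.mem_cons_self) u hu z hz))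
    calc ‖cauchyOp ρ (i :: l) h s σ‖ ≤ ρ / (ρ - 1) ^ 2 * ((ρ / (ρ - 1) ^ 2) ^ l.length * S) := key
      _ = (ρ / (ρ - 1) ^ 2) ^ (i :: l).length * S := by rw [List.length_cons, pow_succ]; ring

/-- The constraint set of (1.23): every listed s(Δ) ∈ [0, 1] and |σ(Δ)| = ρ; it is closed under the moves of
`norm_cauchyOp_le`, whence the bound on it. [folklore] -/
theorem norm_cauchyOp_le' {ρ S : ℝ} (hρ : 1 < ρ) (l : List ι) (h : (ι → ℝ) → (ι → ℂ) → E)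
    (hh : ∀ s σ, (∀ i ∈ l, s i ∈ Set.Icc (0:ℝ) 1 ∧ σ i ∈ Metric.sphere (0:ℂ) ρ) → ‖h s σ‖ ≤ S)
    (s : ι → ℝ) (σ : ι → ℂ) (hsσ : ∀ i ∈ l, s i ∈ Set.Icc (0:ℝ) 1 ∧ σ i ∈ Metric.sphere (0:ℂ) ρ) :
    ‖cauchyOp ρ l h s σ‖ ≤ (ρ / (ρ - 1) ^ 2) ^ l.length * S := by
  refine norm_cauchyOp_le hρ (fun s σ => ∀ i ∈ l, s i ∈ Set.Icc (0:ℝ) 1 ∧ σ i ∈ Metric.sphere (0:ℂ) ρ)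
    l ?_ h hh s σ hsσ
  intro s σ hsσ i _ u hu z hz j hj
  by_cases hji : j = i
  · subst hji; simpa using ⟨hu, by simpa using hz⟩
  · simpa [Function.update_of_ne hji] using hsσ j hj

/-- THE NUMERICAL FACT behind the first exponential of (1.24): with ρ = e^{κ₁} and κ₁ ≥ 1, the per-cube factor
ρ(ρ − 1)⁻² (= ∫₀¹ds·(2π)⁻¹∮|dσ|/|σ − s|² at worst) is ≤ e^{−(κ₁−1)} (cell GAPS C-B13-01: "e^{κ₁}/(e^{κ₁}−1)² ≤
2.503e^{−κ₁} < e^{−(κ₁−1)}"; equivalently ρ² ≤ e(ρ − 1)² for ρ ≥ e). [cite: Balaban1988RG2Cluster, (1.24) p.7] -/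
theorem cauchy_factor_le {κ₁ : ℝ} (hκ : 1 ≤ κ₁) :
    Real.exp κ₁ / (Real.exp κ₁ - 1) ^ 2 ≤ Real.exp (-(κ₁ - 1)) := by
  set ρ := Real.exp κ₁ with hρ
  set e := Real.exp 1 with he
  have he1 : (2.7182818283 : ℝ) < e := Real.exp_one_gt_d9
  have he2 : e < (2.7182818286 : ℝ) := Real.exp_one_lt_d9
  have hρe : e ≤ ρ := Real.exp_le_exp.mpr hκ
  have hρ1 : 0 < ρ - 1 := by linarith
  have hrew : Real.exp (-(κ₁ - 1)) = e / ρ := by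
    rw [hρ, he, ← Real.exp_sub]; ring_nf
  rw [hrew, div_le_div_iff₀ (by positivity) (by positivity)]
  -- ρ·ρ ≤ e (ρ-1)² :  with ρ = e + u, u ≥ 0:  e(ρ-1)² - ρ² = (e³-3e²+e) + (2e²-4e)u + (e-1)u² ≥ 0
  set u := ρ - e with hu
  have hu0 : 0 ≤ u := by linarith
  have q1 : 0 < e ^ 2 - 3 * e + 1 := by nlinarith [mul_self_nonneg (e - 2.7182818283)]
  have t1 : 0 < e * (e ^ 2 - 3 * e + 1) := mul_pos (by linarith) q1
  have t2 : 0 ≤ (2 * e ^ 2 - 4 * e) * u := mul_nonneg (by nlinarith) hu0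
  have t3 : 0 ≤ (e - 1) * u ^ 2 := mul_nonneg (by linarith) (sq_nonneg u)
  have expand : e * (ρ - 1) ^ 2 - ρ * ρ = e * (e ^ 2 - 3 * e + 1) + (2 * e ^ 2 - 4 * e) * u + (e - 1) * u ^ 2 := by
    have : ρ = e + u := by rw [hu]; ring
    rw [this]; ring
  linarith

/-- The product over the N cubes of Y₀∖□̃⁴: (ρ(ρ − 1)⁻²)^N ≤ exp(−(κ₁ − 1)N) = the first exponential
*"exp(−(κ₁ − 1)M⁻⁴|Y₀∖□̃⁴|)"* of (1.24) (N = M⁻⁴|Y₀∖□̃⁴| = the number of M-cubes Δ ⊂ Y₀∖□̃⁴).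
[cite: Balaban1988RG2Cluster, (1.24) p.7] -/
theorem cauchy_factor_pow_le {κ₁ : ℝ} (hκ : 1 ≤ κ₁) (N : ℕ) :
    (Real.exp κ₁ / (Real.exp κ₁ - 1) ^ 2) ^ N ≤ Real.exp (-(κ₁ - 1) * N) := by
  calc (Real.exp κ₁ / (Real.exp κ₁ - 1) ^ 2) ^ N ≤ Real.exp (-(κ₁ - 1)) ^ N :=
        pow_le_pow_left₀ (by positivity) (cauchy_factor_le hκ) N
    _ = Real.exp (-(κ₁ - 1) * N) := by rw [← Real.exp_nat_mul]; ring_nf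

open Complex in
/-- **(1.23) ⇒ (1.24)** p. 7, verbatim: *"We were doing all the considerations for the last term in (I.3.34), hence we
estimate the above expression using (I.3.54). We get |(1.23)| ≦ 8B₀C₁e^{16κ₁}α₂⁻¹g_k|B| E₀(α₁/α₃)⁵(L^jη)⁵ ·
exp(−(κ₁ − 1)M⁻⁴|Y₀∖□̃⁴|) exp(−κd_j(X)). (1.24)"*  KERNEL FORM: for the iterated integral (1.23) over the list
`l` of the N cubes of Y₀∖□̃⁴ (σ-circles of radius e^{κ₁}, κ₁ ≥ 1) and the t_□-circle of radius r with 1/r =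
8B₀C₁e^{16κ₁}α₂⁻¹g_k|B| ((1.22)), and an integrand bounded on the contours by S = E₀(α₁/α₃)⁵(L^jη)⁵exp(−κd_j(X))
((I.3.54) of [Balaban1987RG1] — a HYPOTHESIS `hS'`), the norm is ≤ (1/r)·S·exp(−(κ₁ − 1)N).
[cite: Balaban1988RG2Cluster, (1.24) p.7] -/
theorem bound_124 {κ₁ r S : ℝ} (hκ : 1 ≤ κ₁) (hr : 0 < r) (hS : 0 ≤ S) (l : List ι)
    (h : ℂ → (ι → ℝ) → (ι → ℂ) → E)
    (hS' : ∀ t ∈ Metric.sphere (0:ℂ) r, ∀ s σ,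
      (∀ i ∈ l, s i ∈ Set.Icc (0:ℝ) 1 ∧ σ i ∈ Metric.sphere (0:ℂ) (Real.exp κ₁)) → ‖h t s σ‖ ≤ S)
    (s : ι → ℝ) (σ : ι → ℂ) (hsσ : ∀ i ∈ l, s i ∈ Set.Icc (0:ℝ) 1 ∧ σ i ∈ Metric.sphere (0:ℂ) (Real.exp κ₁)) :
    ‖(2 * Real.pi * I : ℂ)⁻¹ • ∮ t in C(0, r), (t ^ 2)⁻¹ • cauchyOp (Real.exp κ₁) l (h t) s σ‖
      ≤ (1 / r) * S * Real.exp (-(κ₁ - 1) * l.length) := by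
  have hρ : 1 < Real.exp κ₁ := by
    have := Real.add_one_le_exp κ₁; linarith
  have step1 := norm_cauchy_t (E := E) hr (S := (Real.exp κ₁ / (Real.exp κ₁ - 1) ^ 2) ^ l.length * S)
    (Φ := fun t => cauchyOp (Real.exp κ₁) l (h t) s σ)
    (fun t ht => norm_cauchyOp_le' hρ l (h t) (hS' t ht) s σ hsσ)
  refine step1.trans ?_
  have hF := cauchy_factor_pow_le hκ l.length
  have e : (Real.exp κ₁ / (Real.exp κ₁ - 1) ^ 2) ^ l.length * S / r
      = (1 / r) * S * (Real.exp κ₁ / (Real.exp κ₁ - 1) ^ 2) ^ l.length := by ring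
  rw [e]
  exact mul_le_mul_of_nonneg_left hF (by positivity)

end Cauchy

/-! ## Part C. p. 7: (1.24) ⇒ (1.25) -/

/-- **(1.25)** p. 7, verbatim: *"Adding and subtracting ⅛κ₁d_k(□₀) under the first exponential above, we can bound it
by exp(−⅛(κ₁ − 1)d_k(Y) + ⅛κ₁d_k(□₀) − ½(κ₁ − 1)M⁻⁴|Y₀∖□̃⁴|), (1.25) where Y = Y₀ ∪ □₀. Of course Y is a
localization domain form 𝐃_k."*  KERNEL FORM of the exponent comparison under the GEOMETRIC INPUT it silently uses
(cell census G1, a HYPOTHESIS here: d_k(Y) ≤ d_k(□₀) + 4·M⁻⁴|Y₀∖□̃⁴|; the sibling module `…TreeLength` proves the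
adjoining inequality `adjoinLeaf_treeLen` d(Y) ≤ #(Y∖X) + d(X), which gives it with 1 in place of 4 when
Y∖□₀ ⊆ Y₀∖□̃⁴): `dY` = d_k(Y), `d0` = d_k(□₀) ≥ 0, `N` = M⁻⁴|Y₀∖□̃⁴|, κ₁ ≥ 1.
[cite: Balaban1988RG2Cluster, (1.25) p.7] -/
theorem exponent_125 {κ₁ N dY d0 : ℝ} (hκ : 1 ≤ κ₁) (hd0 : 0 ≤ d0) (hG1 : dY ≤ d0 + 4 * N) :
    -(κ₁ - 1) * N ≤ -(1 / 8) * (κ₁ - 1) * dY + (1 / 8) * κ₁ * d0 - (1 / 2) * (κ₁ - 1) * N := by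
  have h1 : (κ₁ - 1) * dY ≤ (κ₁ - 1) * (d0 + 4 * N) := mul_le_mul_of_nonneg_left hG1 (by linarith)
  nlinarith

/-- (1.25) p. 7 as the inequality of exponentials: exp(−(κ₁ − 1)N) ≤ exp(−⅛(κ₁ − 1)d_k(Y) + ⅛κ₁d_k(□₀) − ½(κ₁ − 1)N).
[cite: Balaban1988RG2Cluster, (1.25) p.7] -/
theorem bound_125 {κ₁ N dY d0 : ℝ} (hκ : 1 ≤ κ₁) (hd0 : 0 ≤ d0) (hG1 : dY ≤ d0 + 4 * N) :
    Real.exp (-(κ₁ - 1) * N) ≤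
      Real.exp (-(1 / 8) * (κ₁ - 1) * dY + (1 / 8) * κ₁ * d0 - (1 / 2) * (κ₁ - 1) * N) :=
  Real.exp_le_exp.mpr (exponent_125 hκ hd0 hG1)

/-! ## Part D. p. 8: the sums over X, □′, j, Y₀, □₀ and the gathering (1.29) -/

/-- **(1.27)** threshold, p. 8 *"for κ₁ sufficiently large"* made explicit: n₀·exp(−½(κ₁ − 1)) ≤ 1 as soon as
κ₁ ≥ 1 + 2 log n₀ (n₀ > 0; print: n₀ = 8·12³, so κ₁ ≥ 1 + 2 log 13824 ≈ 20.07). [cite: Balaban1988RG2Cluster, (1.27) p.8] -/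
theorem threshold_127 {n₀ κ₁ : ℝ} (hn : 0 < n₀) (hκ : 1 + 2 * Real.log n₀ ≤ κ₁) :
    n₀ * Real.exp (-(1 / 2) * (κ₁ - 1)) ≤ 1 := by
  have h1 : Real.log n₀ ≤ (1 / 2) * (κ₁ - 1) := by linarith
  have h2 : n₀ ≤ Real.exp ((1 / 2) * (κ₁ - 1)) := by
    calc n₀ = Real.exp (Real.log n₀) := (Real.exp_log hn).symm
      _ ≤ _ := Real.exp_le_exp.mpr h1
  calc n₀ * Real.exp (-(1 / 2) * (κ₁ - 1)) ≤ Real.exp ((1 / 2) * (κ₁ - 1)) * Real.exp (-(1 / 2) * (κ₁ - 1)) :=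
        mul_le_mul_of_nonneg_right h2 (by positivity)
    _ = 1 := by rw [← Real.exp_add]; norm_num

/-- **(1.27)** p. 8, verbatim: *"The sum over Y₀ is simply a sum over subsets of the family of cubes Δ contained in
□₀∖□̃⁴. The number of terms in this sum is an absolute number, but we get a better bound using the last term under
the exponential in (1.25). The sum is bounded by exp(8·12³ exp(−½(κ₁ − 1))) ≦ e (1.27) for κ₁ sufficiently
large."*  KERNEL FORM: for a finite family F of at most 8·12³ cubes (the numeral is the paper's count and is NOT
verified here), Σ_{W⊆F} (e^{−½(κ₁−1)})^{#W} ≤ exp(8·12³·e^{−½(κ₁−1)}) ≤ e once κ₁ ≥ 1 + 2 log(8·12³) (first step =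
`B13.sum_powerset_le_exp_234`, the same computation as (2.34)). [cite: Balaban1988RG2Cluster, (1.27) p.8] -/
theorem bound_127 {α : Type*} [DecidableEq α] (F : Finset α) {κ₁ : ℝ} (hF : (F.card : ℝ) ≤ 8 * 12 ^ 3)
    (hκ : 1 + 2 * Real.log (8 * 12 ^ 3) ≤ κ₁) :
    ∑ W ∈ F.powerset, Real.exp (-(1 / 2) * (κ₁ - 1)) ^ W.card
        ≤ Real.exp (8 * 12 ^ 3 * Real.exp (-(1 / 2) * (κ₁ - 1))) ∧
      Real.exp (8 * 12 ^ 3 * Real.exp (-(1 / 2) * (κ₁ - 1))) ≤ Real.exp 1 := by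
  set t := Real.exp (-(1 / 2) * (κ₁ - 1)) with ht
  have ht0 : 0 ≤ t := by positivity
  refine ⟨(B13.sum_powerset_le_exp_234 F t ht0).trans (Real.exp_le_exp.mpr ?_), Real.exp_le_exp.mpr ?_⟩
  · exact mul_le_mul_of_nonneg_right hF ht0
  · exact threshold_127 (by norm_num) hκ

/-- p. 8, verbatim: *"To bound the first sum, over □′ ⊂ □̃², we use the factor (L^jη)⁵ in (1.24). This yields
(6L)⁴L^jη, and the sum over j is bounded by 2(6L)⁴."*  KERNEL FORM of the j-sum: with η = L^{−k} and L ≥ 2,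
Σ_{j=0}^{k} (6L)⁴L^jη = (6L)⁴ Σ_{j≤k} L^{j−k} ≤ (6L)⁴·L/(L − 1) ≤ 2(6L)⁴.  (The count "(6L)⁴" of cubes □′ ⊂ □̃² is
the paper's and is not verified here.) [cite: Balaban1988RG2Cluster, (1.26)–(1.27) p.8] -/
theorem jsum_le {L : ℝ} (hL : 2 ≤ L) (k : ℕ) :
    ∑ j ∈ Finset.range (k + 1), (6 * L) ^ 4 * (L ^ j * (L ^ k)⁻¹) ≤ 2 * (6 * L) ^ 4 := by
  have hL0 : 0 < L := by linarith
  have hL1 : (1:ℝ) < L := by linarith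
  rw [← Finset.mul_sum]
  have hgeom : ∑ j ∈ Finset.range (k + 1), L ^ j = (L ^ (k + 1) - 1) / (L - 1) :=
    geom_sum_eq hL1.ne' (k + 1)
  have hsum : ∑ j ∈ Finset.range (k + 1), L ^ j * (L ^ k)⁻¹ ≤ 2 := by
    rw [← Finset.sum_mul, hgeom, div_mul_eq_mul_div, div_le_iff₀ (by linarith), pow_succ]
    have hk : 0 < L ^ k := pow_pos hL0 k
    have e : (L ^ k * L - 1) * (L ^ k)⁻¹ = L - (L ^ k)⁻¹ := by field_simp
    rw [e]
    have : 0 < (L ^ k)⁻¹ := inv_pos.mpr hk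
    linarith
  calc (6 * L) ^ 4 * ∑ j ∈ Finset.range (k + 1), L ^ j * (L ^ k)⁻¹ ≤ (6 * L) ^ 4 * 2 :=
        mul_le_mul_of_nonneg_left hsum (by positivity)
    _ = 2 * (6 * L) ^ 4 := by ring

/-- THE ELEMENTARY FACT behind (1.28) and the p. 9 cube sum: A·d ≤ exp(c·d) for all d ≥ 1 as soon as c ≥ log A and
c ≥ 1 (A > 0): exp(cd) = exp(c)·exp(c(d − 1)) ≥ A·(1 + c(d − 1)) ≥ A·d. [folklore] -/
theorem lin_le_exp {A c d : ℝ} (hA : 0 < A) (hcA : Real.log A ≤ c) (hc1 : 1 ≤ c) (hd : 1 ≤ d) :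
    A * d ≤ Real.exp (c * d) := by
  have h1 : A ≤ Real.exp c := by
    calc A = Real.exp (Real.log A) := (Real.exp_log hA).symm
      _ ≤ Real.exp c := Real.exp_le_exp.mpr hcA
  have h2 : d ≤ Real.exp (c * (d - 1)) := by
    have := Real.add_one_le_exp (c * (d - 1))
    nlinarith
  calc A * d ≤ Real.exp c * Real.exp (c * (d - 1)) :=
        mul_le_mul h1 h2 (by linarith) (by positivity)
    _ = Real.exp (c * d) := by rw [← Real.exp_add]; ring_nf

/-- log 24 ≥ 1 (e < 24), used to run `lin_le_exp` with A = 3·2³ = 24. [folklore] -/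
theorem one_le_log_24 : (1:ℝ) ≤ Real.log 24 := by
  rw [Real.le_log_iff_exp_le (by norm_num)]
  have := Real.exp_one_lt_d9
  linarith

/-- **(1.28)** p. 8 AS PRINTED, verbatim: *"Finally, the sum over □₀ can be bounded by M⁻⁴|Y| ≦ 3·2³d_k(Y) ≦
exp(1/16)(κ₁ − 2)d_k(Y). (1.28)"*  The first "≦" is the printed lower half of (2.30) (cell GAPS G-B13-07: FALSE for
domains of linear size 0 — it enters here as the HYPOTHESIS `hG2`, see `bound_128_repaired` for the true form);
the second holds for d_k(Y) ≥ 1 once κ₁ ≥ 2 + 16 log 24 — an UNPRINTED, implicit restriction (no proviso follows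
(1.28) in print: the display comes right after the full stop of *"for κ₁ sufficiently large."*, which qualifies
(1.27)); the kernel makes it explicit as (1/16)(κ₁ − 2) ≥ log(3·2³) (v1.1 wording, cell GAPS G-pv14-6).
[cite: Balaban1988RG2Cluster, (1.28) p.8] -/
theorem bound_128_printed {N d κ₁ : ℝ} (hG2 : N ≤ 24 * d) (hd : 1 ≤ d) (hκ : 2 + 16 * Real.log 24 ≤ κ₁) :
    24 * d ≤ Real.exp ((1 / 16) * (κ₁ - 2) * d) ∧ N ≤ Real.exp ((1 / 16) * (κ₁ - 2) * d) := by
  have hc : Real.log 24 ≤ (1 / 16) * (κ₁ - 2) := by linarith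
  have h := lin_le_exp (A := 24) (by norm_num) hc (one_le_log_24.trans hc) hd
  exact ⟨h, hG2.trans h⟩

/-- THE ELEMENTARY FACT behind the REPAIRED (1.28): A(d + 1) ≤ exp(c·d) for all d ≥ d₀ as soon as
c·d₀ ≥ log(A(d₀ + 1)) and A(d₀ + 1) ≥ e (A, d₀ > 0): exp(cd) ≥ A(d₀+1)(1 + c(d − d₀)) ≥ A(d₀+1) + A(d − d₀).
[folklore] -/
theorem affine_le_exp {A c d d₀ : ℝ} (hA : 0 < A) (hd₀ : 0 < d₀) (he : Real.exp 1 ≤ A * (d₀ + 1))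
    (hc : Real.log (A * (d₀ + 1)) ≤ c * d₀) (hd : d₀ ≤ d) : A * (d + 1) ≤ Real.exp (c * d) := by
  have hAd : 0 < A * (d₀ + 1) := by positivity
  have h1 : A * (d₀ + 1) ≤ Real.exp (c * d₀) := by
    calc A * (d₀ + 1) = Real.exp (Real.log (A * (d₀ + 1))) := (Real.exp_log hAd).symm
      _ ≤ Real.exp (c * d₀) := Real.exp_le_exp.mpr hc
  have hc1 : 1 ≤ c * d₀ := by
    have : Real.log (Real.exp 1) ≤ Real.log (A * (d₀ + 1)) := Real.log_le_log (Real.exp_pos 1) he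
    rw [Real.log_exp] at this
    linarith
  have hc0 : 0 ≤ c := by
    by_contra hneg
    have hneg' : c ≤ 0 := (not_le.mp hneg).le
    nlinarith [mul_nonneg (neg_nonneg.mpr hneg') hd₀.le]
  have h2 : 1 + c * (d - d₀) ≤ Real.exp (c * (d - d₀)) := by
    have := Real.add_one_le_exp (c * (d - d₀)); linarith
  have h3 : A * (d + 1) ≤ A * (d₀ + 1) * (1 + c * (d - d₀)) := by
    -- A(d+1) = A(d₀+1) + A(d-d₀) and A(d₀+1)·c(d-d₀) ≥ A(d-d₀) since c(d₀+1) ≥ c d₀ ≥ 1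
    have hdd : 0 ≤ d - d₀ := by linarith
    have : A * (d - d₀) ≤ A * (d₀ + 1) * (c * (d - d₀)) := by
      have e : A * (d₀ + 1) * (c * (d - d₀)) = A * (d - d₀) * (c * d₀ + c) := by ring
      rw [e]
      have : 1 ≤ c * d₀ + c := by linarith
      nlinarith [mul_nonneg hA.le hdd]
    nlinarith
  calc A * (d + 1) ≤ A * (d₀ + 1) * (1 + c * (d - d₀)) := h3
    _ ≤ Real.exp (c * d₀) * Real.exp (c * (d - d₀)) :=
        mul_le_mul h1 h2 (by nlinarith [mul_nonneg hc0 (show 0 ≤ d - d₀ by linarith)]) (by positivity)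
    _ = Real.exp (c * d) := by rw [← Real.exp_add]; ring_nf

/-- **(1.28) REPAIRED** (cell GAPS G-B13-07: the true lower-volume bound is additive, N ≤ A(d_k(Y) + 1) — the sibling
module `…TreeLength` PROVES `card_le_treeLen` |Y| ≤ 2^d(4d(Y) + 1), i.e. A = 64 in d = 4 — together with an explicit
floor d_k(Y) ≥ d₀ > 0 for the domains arising, cf. p. 8 *"we sum over X with d_j(X) ≠ 0, as it follows from
our inductive construction"*): then the sum over □₀ ⊂ Y has N ≤ exp(c·d_k(Y)) terms for every rate c with
c·d₀ ≥ log(A(d₀ + 1)) (and A(d₀ + 1) ≥ e); (1.28) is the case c = (1/16)(κ₁ − 2), i.e. κ₁ ≥ 2 + 16 log(A(d₀+1))/d₀.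
[cite: Balaban1988RG2Cluster, (1.28) p.8] -/
theorem bound_128_repaired {N A d d₀ κ₁ : ℝ} (hA : 0 < A) (hd₀ : 0 < d₀) (he : Real.exp 1 ≤ A * (d₀ + 1))
    (hG2 : N ≤ A * (d + 1)) (hd : d₀ ≤ d) (hκ : Real.log (A * (d₀ + 1)) ≤ (1 / 16) * (κ₁ - 2) * d₀) :
    N ≤ Real.exp ((1 / 16) * (κ₁ - 2) * d) :=
  hG2.trans (affine_le_exp hA hd₀ he hκ hd)

/-- **(1.29)** p. 8, the EXACT exponent bookkeeping behind *"Gathering together the above bounds we obtain |Σ(1.23)| ≦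
E₀ε₁O(M^q) exp O(1)κ₁ exp(−(1/16)κ₁d_k(Y)), (1.29)"*: the d_k(Y)-rates of (1.25) and (1.28) combine as
−⅛(κ₁ − 1) + (1/16)(κ₁ − 2) = −(1/16)κ₁ exactly, the ⅛κ₁d_k(□₀) of (1.25) going into "exp O(1)κ₁".
[cite: Balaban1988RG2Cluster, (1.29) p.8] -/
theorem exponent_129 (κ₁ d d0 : ℝ) :
    Real.exp (-(1 / 8) * (κ₁ - 1) * d + (1 / 8) * κ₁ * d0) * Real.exp ((1 / 16) * (κ₁ - 2) * d)
      = Real.exp ((1 / 8) * κ₁ * d0) * Real.exp (-(1 / 16) * κ₁ * d) := by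
  rw [← Real.exp_add, ← Real.exp_add]; ring_nf

/-- Sum of a function bounded by a constant: Σ_{x∈s} f x ≤ #s · C. [folklore] -/
theorem sum_le_card_mul {α : Type*} (s : Finset α) (f : α → ℝ) (C : ℝ) (h : ∀ x ∈ s, f x ≤ C) :
    ∑ x ∈ s, f x ≤ s.card * C := by
  have := Finset.sum_le_card_nsmul s f C h
  simpa [nsmul_eq_mul] using this

/-- **(1.29)** p. 8, *"Gathering together the above bounds"* — the NESTED-SUM BOOKKEEPING kernel-checked over abstract
finite index sets: □₀ ∈ `S0` (⊂ Y), Y₀ ∈ `SY □₀`, j ∈ {0,…,k}, □′ ∈ `Sq j` (⊂ □̃²), X ∈ `SX j □′` (X ∈ 𝐃_j, X ⊃ □′),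
with terms bounded pointwise by (1.24)×(1.25) (`hT`: K = 8B₀C₁e^{16κ₁}α₂⁻¹g_k|B|E₀(α₁/α₃)⁵, ℓ_j = L^jη),
and the level bounds exactly as the text states them: (1.26) Σ_X exp(−κd_j(X)) ≦ O(1) (`hX`, kernel elsewhere:
`…B12TreeDecay`), the □′-count *"This yields (6L)⁴L^jη"* (`hq`), the j-sum *"bounded by 2(6L)⁴"* (`hj`, kernel:
`jsum_le`), (1.27) (`hY`, kernel: `bound_127`), (1.28) (`h0`, kernel: `bound_128_printed`/`_repaired`).  CONCLUSION:
the whole sum is ≤ K·O(1)·2(6L)⁴·e·exp(⅛κ₁d_k(□₀))·exp(−(1/16)κ₁d_k(Y)) — the printed shape E₀ε₁O(M^q)exp O(1)κ₁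
exp(−(1/16)κ₁d_k(Y)) with every factor explicit ("O(M^q)" presupposes B12's α_i = powers of M and is not asserted).
[cite: Balaban1988RG2Cluster, (1.29) p.8] -/
theorem gather_129 {α β γ δ : Type*} (S0 : Finset α) (SY : α → Finset β) (k : ℕ) (Sq : ℕ → Finset γ)
    (SX : ℕ → γ → Finset δ) (T : α → β → ℕ → γ → δ → ℝ) (ℓ : ℕ → ℝ) (dj : ℕ → γ → δ → ℝ) (n : α → β → ℝ)
    {K O1 L d d0 κ κ₁ : ℝ} (hK : 0 ≤ K) (hO1 : 0 ≤ O1) (hℓ : ∀ j, 0 ≤ ℓ j)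
    (hT : ∀ a ∈ S0, ∀ y ∈ SY a, ∀ j ∈ Finset.range (k + 1), ∀ q ∈ Sq j, ∀ x ∈ SX j q,
      T a y j q x ≤ K * ℓ j ^ 5 * Real.exp (-(κ * dj j q x)) *
        Real.exp (-(1 / 8) * (κ₁ - 1) * d + (1 / 8) * κ₁ * d0 - (1 / 2) * (κ₁ - 1) * n a y))
    (hX : ∀ j ∈ Finset.range (k + 1), ∀ q ∈ Sq j, ∑ x ∈ SX j q, Real.exp (-(κ * dj j q x)) ≤ O1)
    (hq : ∀ j ∈ Finset.range (k + 1), ((Sq j).card : ℝ) * ℓ j ^ 5 ≤ (6 * L) ^ 4 * ℓ j)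
    (hj : ∑ j ∈ Finset.range (k + 1), (6 * L) ^ 4 * ℓ j ≤ 2 * (6 * L) ^ 4)
    (hY : ∀ a ∈ S0, ∑ y ∈ SY a, Real.exp (-(1 / 2) * (κ₁ - 1) * n a y) ≤ Real.exp 1)
    (h0 : (S0.card : ℝ) ≤ Real.exp ((1 / 16) * (κ₁ - 2) * d)) :
    ∑ a ∈ S0, ∑ y ∈ SY a, ∑ j ∈ Finset.range (k + 1), ∑ q ∈ Sq j, ∑ x ∈ SX j q, T a y j q x
      ≤ K * O1 * (2 * (6 * L) ^ 4) * Real.exp 1 * Real.exp ((1 / 8) * κ₁ * d0) *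
        Real.exp (-(1 / 16) * κ₁ * d) := by
  -- abbreviations
  set A := Real.exp (-(1 / 8) * (κ₁ - 1) * d + (1 / 8) * κ₁ * d0) with hA
  have hA0 : 0 < A := Real.exp_pos _
  have hsplit : ∀ a y, Real.exp (-(1 / 8) * (κ₁ - 1) * d + (1 / 8) * κ₁ * d0 - (1 / 2) * (κ₁ - 1) * n a y)
      = A * Real.exp (-(1 / 2) * (κ₁ - 1) * n a y) := by
    intro a y; rw [hA, ← Real.exp_add]; ring_nf
  -- level X
  have hLX : ∀ a ∈ S0, ∀ y ∈ SY a, ∀ j ∈ Finset.range (k + 1), ∀ q ∈ Sq j,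
      ∑ x ∈ SX j q, T a y j q x ≤ K * ℓ j ^ 5 * O1 * (A * Real.exp (-(1 / 2) * (κ₁ - 1) * n a y)) := by
    intro a ha y hy j hj' q hq'
    calc ∑ x ∈ SX j q, T a y j q x
        ≤ ∑ x ∈ SX j q, K * ℓ j ^ 5 * Real.exp (-(κ * dj j q x)) * (A * Real.exp (-(1 / 2) * (κ₁ - 1) * n a y)) :=
          Finset.sum_le_sum fun x hx => by rw [← hsplit]; exact hT a ha y hy j hj' q hq' x hx
      _ = K * ℓ j ^ 5 * (A * Real.exp (-(1 / 2) * (κ₁ - 1) * n a y)) * ∑ x ∈ SX j q, Real.exp (-(κ * dj j q x)) := by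
          rw [Finset.mul_sum]; refine Finset.sum_congr rfl fun x _ => by ring
      _ ≤ K * ℓ j ^ 5 * (A * Real.exp (-(1 / 2) * (κ₁ - 1) * n a y)) * O1 :=
          mul_le_mul_of_nonneg_left (hX j hj' q hq')
            (mul_nonneg (mul_nonneg hK (pow_nonneg (hℓ j) 5)) (by positivity))
      _ = _ := by ring
  -- level □′
  have hLq : ∀ a ∈ S0, ∀ y ∈ SY a, ∀ j ∈ Finset.range (k + 1),
      ∑ q ∈ Sq j, ∑ x ∈ SX j q, T a y j q x ≤ K * O1 * ((6 * L) ^ 4 * ℓ j) * (A * Real.exp (-(1 / 2) * (κ₁ - 1) * n a y)) := by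
    intro a ha y hy j hj'
    calc ∑ q ∈ Sq j, ∑ x ∈ SX j q, T a y j q x
        ≤ (Sq j).card * (K * ℓ j ^ 5 * O1 * (A * Real.exp (-(1 / 2) * (κ₁ - 1) * n a y))) :=
          sum_le_card_mul _ _ _ fun q hq' => hLX a ha y hy j hj' q hq'
      _ = K * O1 * (((Sq j).card : ℝ) * ℓ j ^ 5) * (A * Real.exp (-(1 / 2) * (κ₁ - 1) * n a y)) := by ring
      _ ≤ K * O1 * ((6 * L) ^ 4 * ℓ j) * (A * Real.exp (-(1 / 2) * (κ₁ - 1) * n a y)) := by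
          refine mul_le_mul_of_nonneg_right (mul_le_mul_of_nonneg_left (hq j hj') (by positivity)) (by positivity)
  -- level j
  have hLj : ∀ a ∈ S0, ∀ y ∈ SY a,
      ∑ j ∈ Finset.range (k + 1), ∑ q ∈ Sq j, ∑ x ∈ SX j q, T a y j q x
        ≤ K * O1 * (2 * (6 * L) ^ 4) * (A * Real.exp (-(1 / 2) * (κ₁ - 1) * n a y)) := by
    intro a ha y hy
    calc ∑ j ∈ Finset.range (k + 1), ∑ q ∈ Sq j, ∑ x ∈ SX j q, T a y j q x
        ≤ ∑ j ∈ Finset.range (k + 1), K * O1 * ((6 * L) ^ 4 * ℓ j) * (A * Real.exp (-(1 / 2) * (κ₁ - 1) * n a y)) :=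
          Finset.sum_le_sum fun j hj' => hLq a ha y hy j hj'
      _ = K * O1 * (A * Real.exp (-(1 / 2) * (κ₁ - 1) * n a y)) * ∑ j ∈ Finset.range (k + 1), (6 * L) ^ 4 * ℓ j := by
          rw [Finset.mul_sum]; refine Finset.sum_congr rfl fun j _ => by ring
      _ ≤ K * O1 * (A * Real.exp (-(1 / 2) * (κ₁ - 1) * n a y)) * (2 * (6 * L) ^ 4) :=
          mul_le_mul_of_nonneg_left hj (by positivity)
      _ = _ := by ring
  -- level Y₀
  have hLY : ∀ a ∈ S0, ∑ y ∈ SY a, ∑ j ∈ Finset.range (k + 1), ∑ q ∈ Sq j, ∑ x ∈ SX j q, T a y j q x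
      ≤ K * O1 * (2 * (6 * L) ^ 4) * A * Real.exp 1 := by
    intro a ha
    calc ∑ y ∈ SY a, ∑ j ∈ Finset.range (k + 1), ∑ q ∈ Sq j, ∑ x ∈ SX j q, T a y j q x
        ≤ ∑ y ∈ SY a, K * O1 * (2 * (6 * L) ^ 4) * (A * Real.exp (-(1 / 2) * (κ₁ - 1) * n a y)) :=
          Finset.sum_le_sum fun y hy => hLj a ha y hy
      _ = K * O1 * (2 * (6 * L) ^ 4) * A * ∑ y ∈ SY a, Real.exp (-(1 / 2) * (κ₁ - 1) * n a y) := by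
          rw [Finset.mul_sum]; refine Finset.sum_congr rfl fun y _ => by ring
      _ ≤ K * O1 * (2 * (6 * L) ^ 4) * A * Real.exp 1 := mul_le_mul_of_nonneg_left (hY a ha) (by positivity)
  -- level □₀ and the exponent identity
  have hL6 : (0:ℝ) ≤ 2 * (6 * L) ^ 4 := by
    have : (0:ℝ) ≤ (6 * L) ^ 4 := by positivity
    linarith
  calc ∑ a ∈ S0, ∑ y ∈ SY a, ∑ j ∈ Finset.range (k + 1), ∑ q ∈ Sq j, ∑ x ∈ SX j q, T a y j q x
      ≤ S0.card * (K * O1 * (2 * (6 * L) ^ 4) * A * Real.exp 1) := sum_le_card_mul _ _ _ hLY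
    _ ≤ Real.exp ((1 / 16) * (κ₁ - 2) * d) * (K * O1 * (2 * (6 * L) ^ 4) * A * Real.exp 1) :=
        mul_le_mul_of_nonneg_right h0 (by positivity)
    _ = K * O1 * (2 * (6 * L) ^ 4) * Real.exp 1 * (A * Real.exp ((1 / 16) * (κ₁ - 2) * d)) := by ring
    _ = _ := by rw [hA, exponent_129]; ring

/-! ## Part E. p. 9: (1.30)–(1.32), the factor L^jη, the cube sum, and the rate of (1.36) -/

/-- **(1.31) ⇒ (1.32)** p. 9, verbatim: *"By the definition of the linear size functions they satisfy the following
fundamental scaling inequality d_j(X) ≧ (L^jη)⁻¹d_k(X₀). (1.31) It implies that the last two exponentials in (1.30)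
can be bounded by exp(−(1 − δ)κd_k(Y) − δκd_j(X)), (1.32) if ¼(κ₁ − 1) ≧ (1 − δ)κ, 0 < δ < 1."* — the last two
exponentials of (1.30) being exp(−(κ₁ − 1)M⁻⁴|Y∖X₀|) exp(−κd_j(X)).  KERNEL FORM with the inputs as HYPOTHESES:
`h131` = (1.31) in the form d_k(X₀) ≤ (L^jη)·d_j(X) with L^jη ≤ 1, `hG1` = the geometric input d_k(Y) ≤ d_k(X₀) +
4M⁻⁴|Y∖X₀| (cell census G1; `…TreeLength.adjoinLeaf_treeLen` gives coefficient 1), `hR8` = the printed proviso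
(restriction R8). [cite: Balaban1988RG2Cluster, (1.31)–(1.32) p.9] -/
theorem bound_132 {κ κ₁ δ n dY dX0 djX ℓ : ℝ} (hκ : 0 ≤ κ) (hδ1 : δ < 1)
    (hR8 : (1 - δ) * κ ≤ (1 / 4) * (κ₁ - 1)) (hℓ1 : ℓ ≤ 1) (hdj : 0 ≤ djX)
    (h131 : dX0 ≤ ℓ * djX) (hn : 0 ≤ n) (hG1 : dY ≤ dX0 + 4 * n) :
    Real.exp (-(κ₁ - 1) * n) * Real.exp (-(κ * djX)) ≤ Real.exp (-(1 - δ) * κ * dY - δ * κ * djX) := by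
  rw [← Real.exp_add]
  apply Real.exp_le_exp.mpr
  have hc : 0 ≤ (1 - δ) * κ := mul_nonneg (by linarith) hκ
  have h1 : dX0 ≤ djX := h131.trans (by nlinarith)
  have h2 : dY ≤ djX + 4 * n := by linarith
  have h3 : (1 - δ) * κ * dY ≤ (1 - δ) * κ * (djX + 4 * n) := mul_le_mul_of_nonneg_left h2 hc
  have h4 : 4 * ((1 - δ) * κ) * n ≤ (κ₁ - 1) * n := mul_le_mul_of_nonneg_right (by linarith) hn
  nlinarith

/-- p. 9, verbatim: *"Next we sum over the cubes □′, and this sum is controlled by the first exponential in (1.30). The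
first term under the exponential gives also the factor L^jη, which controls the sum over j."* — the first term being
−½δ₀M(L^jη)⁻¹ (display after (1.29) p. 8).  KERNEL FORM: exp(−½a/ℓ) ≤ ℓ for every 0 < ℓ (= L^jη) as soon as
a (= δ₀M) ≥ 2e⁻¹ (in particular under R24 of the cell census, κ ≤ δ₀M with κ ≥ 1): from x e^{−x} ≤ e^{−1} at x = a/(2ℓ).
[cite: Balaban1988RG2Cluster, (1.30) p.9] -/
theorem factor_Ljη {a ℓ : ℝ} (hℓ : 0 < ℓ) (ha : 2 * Real.exp (-1) ≤ a) :
    Real.exp (-(1 / 2) * a * ℓ⁻¹) ≤ ℓ := by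
  have ha0 : 0 < a := lt_of_lt_of_le (by positivity) ha
  set x := (1 / 2) * a * ℓ⁻¹ with hx
  have hx0 : 0 < x := by positivity
  -- x·e^{−x} ≤ e^{−1} (from 1 + y ≤ e^y at y = x − 1)
  have h : x * Real.exp (-x) ≤ Real.exp (-1) := by
    have hx1 : x ≤ Real.exp (x - 1) := by have := Real.add_one_le_exp (x - 1); linarith
    calc x * Real.exp (-x) ≤ Real.exp (x - 1) * Real.exp (-x) :=
          mul_le_mul_of_nonneg_right hx1 (by positivity)
      _ = Real.exp (-1) := by rw [← Real.exp_add]; ring_nf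
  have h' : Real.exp (-x) ≤ Real.exp (-1) / x := by
    rw [le_div_iff₀ hx0]; linarith
  have hxe : Real.exp (-1) / x ≤ ℓ := by
    rw [div_le_iff₀ hx0, hx]
    have : ℓ * ((1 / 2) * a * ℓ⁻¹) = (1 / 2) * a := by field_simp
    rw [this]; linarith
  have : -(1 / 2) * a * ℓ⁻¹ = -x := by rw [hx]; ring
  rw [this]
  exact h'.trans hxe

/-- p. 9, verbatim: *"Finally, the sum over all possible cubes □ can be bounded by M⁻⁴|Y| ≦ 3·2³d_k(Y) ≦ exp δκd_k(Y)."*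
— AS PRINTED (first "≦" = G2, hypothesis, cf. `bound_128_repaired`); the second "≦" carries NO printed proviso: it
holds for d_k(Y) ≥ 1 under the implicit threshold δκ ≥ log 24, which the kernel makes explicit (the printed *"and the
inequality (1.26) for δκ sufficiently large"* of the same paragraph qualifies the use of (1.26), two sentences before
this display — v1.1 wording, cell GAPS G-pv14-6). [cite: Balaban1988RG2Cluster, (1.32) p.9] -/
theorem cubesum_p9 {N d δ κ : ℝ} (hG2 : N ≤ 24 * d) (hd : 1 ≤ d) (h : Real.log 24 ≤ δ * κ) :
    24 * d ≤ Real.exp (δ * κ * d) ∧ N ≤ Real.exp (δ * κ * d) := by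
  have h1 := lin_le_exp (A := 24) (by norm_num) h (one_le_log_24.trans h) hd
  exact ⟨h1, hG2.trans h1⟩

/-- p. 9, verbatim: *"These estimates yield again a bound of the form (1.29) for the considered sum, with the last
exponential replaced by exp(−(1 − 2δ)κd_k(Y)). We assume that (1/16)κ₁ ≧ (1 − 2δ)κ, hence we can bound both sums
by the above exponential."* (restriction R9): exp(−(1/16)κ₁d) ≤ exp(−(1 − 2δ)κd) for d ≥ 0.
[cite: Balaban1988RG2Cluster, (1.36) p.9] -/
theorem rate_R9 {κ κ₁ δ d : ℝ} (hd : 0 ≤ d) (hR9 : (1 - 2 * δ) * κ ≤ (1 / 16) * κ₁) :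
    Real.exp (-(1 / 16) * κ₁ * d) ≤ Real.exp (-(1 - 2 * δ) * κ * d) := by
  apply Real.exp_le_exp.mpr
  nlinarith

/-- **(1.29) + R9 ⇒ the shape (1.36)** of Lemma 1 p. 9 (*"|V′_k(Y, U, J, B)| ≦ E₀ε₁C₁M^q exp C₂κ₁ exp(−(1 − 2δ)κd_k(Y)).
(1.36)"*): a bound P·exp(−(1/16)κ₁d_k(Y)) with P ≥ 0 implies P·exp(−(1 − 2δ)κd_k(Y)) under R9 — pure monotonicity;
the identification P = E₀ε₁C₁M^q exp C₂κ₁ is the paper's and is not asserted. [cite: Balaban1988RG2Cluster, (1.36) p.9] -/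
theorem shape_136 {V P κ κ₁ δ d : ℝ} (hP : 0 ≤ P) (hd : 0 ≤ d) (hR9 : (1 - 2 * δ) * κ ≤ (1 / 16) * κ₁)
    (h129 : V ≤ P * Real.exp (-(1 / 16) * κ₁ * d)) : V ≤ P * Real.exp (-(1 - 2 * δ) * κ * d) :=
  h129.trans (mul_le_mul_of_nonneg_left (rate_R9 hd hR9) hP)

end Literature.MathematicalPhysics.QuantumFieldTheory.Balaban1983to89.B13Sect1Arith
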